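import Summits.RiemannHypothesis.RiemannHypothesis.Theses.DisplacementPencil

/-!
# Birth skeleton — crux `PencilBase` (stmt-RiemannHypothesis-17888), route `DisplacementPencil`

Crux (route decl, verbatim): `HasOnlyRealZeros P₄` for the base rung of the displacement pencil,
`P₄(z) := 4·Ξ(z) + Ξ(z + i) + Ξ(z − i)` (`Ξ = riemannXiUpper`), i.e. every zero of `P₄` is real.

Skeleton (three registered stubs; composition `PencilBase_of` proved below, no `sorry` outside
`stub_*`). It is the route's own two-layer plan for this crux ("PencilBase ⇐ High4 → Box4",
route header TWO-LAYER PLAN) with the one analytic lemma that makes the box genuinely BOUNDED: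

* `stub_strip4` — A-PRIORI STRIP (analytic, size M): every zero of `P₄` has `|Im z| < 40`.
  Mechanism: `P₄` is even, so take `y = Im z ≥ 40`; with `u := 1/2 + y − i·Re z` (`Re u ≥ 40.5`)
  the functional equation gives `Ξ(z) = ξ(u)`, `Ξ(z+i) = ξ(u+1)`, `Ξ(z−i) = ξ(u−1)`, so
  `P₄(z)/ξ(u) = 4 + R(u) + 1/R(u−1)` with `R(u) := ξ(u+1)/ξ(u) = (u/2π)^{1/2}(1+δ)`, `|δ| ≤ 0.06`
  for `Re u ≥ 39.5` (Stirling for `Γ((u+1)/2)/Γ(u/2)`, `|ζ(u) − 1| ≤ 2^{-38}`, `(u+1)/(u−1)`);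
  `|arg u| < π/2` puts `arg R(u)`, `arg (1/R(u−1))` inside `(−π/4 − 0.06, π/4 + 0.06)`, hence
  `Re (P₄(z)/ξ(u)) > 4 > 0`. (Refuter evidence on the item, CRUX-ATTACK-PencilBase.md: "|Im z| ≥ 40
  excluded on paper (Stirling phase bounds)"; the constant 40 is theirs, so their validated box
  counts `N_box(T, 40)` are counts for `stub_box4`'s box.)
* `stub_high4` — EXPLICIT DOMINANCE / COMB (analytic, size L): a zero with `|Re z| ≥ 3·10⁷` and
  `|Im z| < 40` is real. On the axis `P₄(t) = 4Ξ(t) + 2 Re Ξ(t+i)` and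
  `|Ξ(t+i)/Ξ(t)| = (t/2π)^{1/2}|ζ(3/2+it)|/|ζ(1/2+it)| ≥ (t/2π)^{1/2}(ζ(3)/ζ(3/2))/(0.618 t^{1/6} log t)`
  (HiaryPatelYang2024 Thm 1.1), which exceeds `2 × 2.7` for `t ≥ 3·10⁷` (`1005` against `375`):
  the displaced carrier beats `4Ξ` at every carrier extremum with margin, its phase is strictly
  monotone, so `P₄` changes sign once per carrier half-period; a Rouché count of `P₄` against
  `P₀ = Ξ(·+i) + Ξ(·−i)` (all zeros real: Bruijn1950, Lagarias2005 Thm 2.1) in boxes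
  `[T_k, T_{k+1}] × [−40, 40]` (top/bottom sides: the `ξ(u+1)` term dominates by a factor ≈ 2·10³)
  shows there are no further zeros. This is the route's support item `HighReal` at `c = 4` with the
  constant made explicit.
* `stub_box4` — CERTIFIED BOX (computation, size L): a zero with `|Re z| < 3·10⁷`, `|Im z| < 40` is
  real. Protocol (route header, item docstring (ii)): certified sign changes of the real function
  `P₄(t)` on `(−3·10⁷, 3·10⁷)` (Riemann–Siegel for `ζ` at `σ = 1/2, 3/2` in ball arithmetic,
  ≈ 7·10⁷ zeros) against the argument-principle count on the boundary of the box; equality ⇒ all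
  zeros in the box real (and simple). Done to `|Re z| < 4·10⁴` in double precision + Arb signs by
  the refuter (kit:j023191: 49395 = 49395, `N_box(T,40)/2 − S_F(T) = 0` at 8 checkpoints).

Shape (tree convention, cf. `Cruxes/AhfHighReal/Lines/birth.lean`): the three statements are named
propositions `Sig.stub_*` (same short names as the registered stubs, so the skeleton audit admits
them as hypotheses); the registered stubs `stub_*` spell the signatures out verbatim (`sorry` lives
ONLY there); `PencilBase_of (hS : Sig.stub_strip4) (hH : Sig.stub_high4) (hB : Sig.stub_box4) :
PencilBase` is the sorry-free composition (strip confinement, then a case split at `|Re z| = 3·10⁷`),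
and `PencilBase_proof : PencilBase := PencilBase_of stub_strip4 stub_high4 stub_box4` is the
skeleton theorem concluding the crux BY NAME.

Disproof used: none on file (`ledger crux ls stmt-RiemannHypothesis-17888`: no Disproof.lean, no
Negative lemmas, 2026-08-17). All three stubs are implied by the crux itself (restrictions of
`PencilBase` to regions, resp. a consequence of it), so none is an instance of a refutable
strengthening; none implies the crux or the summit on its own (BC3 probes, folder `bc/`).
-/

namespace Summit.RiemannHypothesis.RiemannHypothesis.Cruxes.PencilBase.Birth

open Summit.RiemannHypothesis.RiemannHypothesis.Theses.DisplacementPencil (PencilBase)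

/-! ## The three stub statements as named propositions `Sig.stub_*` -/

namespace Sig

/-- **Stub 1 (A-PRIORI STRIP).** Every zero `z` of `P₄ = 4Ξ + Ξ(·+i) + Ξ(·−i)` has `|Im z| < 40`.
Implied by the crux; as an unconditional theorem: functional equation + Stirling phase bound
(`Re (P₄(z)/ξ(1/2 + Im z − i Re z)) > 4` for `Im z ≥ 40`, evenness for `Im z ≤ −40`). Size: M. -/
def stub_strip4 : Prop :=
  ∀ z : ℂ,
    (4 : ℂ) * Literature.NumberTheory.LFunctions.riemannXiUpper z +
          Literature.NumberTheory.LFunctions.riemannXiUpper (z + Complex.I) +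
        Literature.NumberTheory.LFunctions.riemannXiUpper (z - Complex.I) = 0 →
      |z.im| < 40

/-- **Stub 2 (EXPLICIT DOMINANCE / COMB, the far region).** A zero `z` of `P₄` with
`3·10⁷ ≤ |Re z|` and `|Im z| < 40` is real. Implied by the crux; as an unconditional theorem:
carrier dominance from `|ζ(1/2+it)| ≤ 0.618 t^{1/6} log t` (HiaryPatelYang2024) against
`(t/2π)^{1/2} ζ(3)/ζ(3/2)`, strictly monotone carrier phase, Rouché count against
`P₀ = Ξ(·+i) + Ξ(·−i)` (real-rooted: Bruijn1950, Lagarias2005 Thm 2.1). Size: L. -/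
def stub_high4 : Prop :=
  ∀ z : ℂ,
    (4 : ℂ) * Literature.NumberTheory.LFunctions.riemannXiUpper z +
          Literature.NumberTheory.LFunctions.riemannXiUpper (z + Complex.I) +
        Literature.NumberTheory.LFunctions.riemannXiUpper (z - Complex.I) = 0 →
      (3 * 10 ^ 7 : ℝ) ≤ |z.re| → |z.im| < 40 → z.im = 0

/-- **Stub 3 (CERTIFIED BOX).** A zero `z` of `P₄` with `|Re z| < 3·10⁷` and `|Im z| < 40` is real.
Implied by the crux; as an unconditional theorem: a certified (ball-arithmetic) sign-change count of
`P₄(t)`, `|t| < 3·10⁷`, matched against the argument-principle count on the box boundary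
(PlattTrudgian2021-style; refuter census kit:j023191 covers `|Re z| < 4·10⁴`). Size: L. -/
def stub_box4 : Prop :=
  ∀ z : ℂ,
    (4 : ℂ) * Literature.NumberTheory.LFunctions.riemannXiUpper z +
          Literature.NumberTheory.LFunctions.riemannXiUpper (z + Complex.I) +
        Literature.NumberTheory.LFunctions.riemannXiUpper (z - Complex.I) = 0 →
      |z.re| < (3 * 10 ^ 7 : ℝ) → |z.im| < 40 → z.im = 0

end Sig

/-! ## The registered stubs (full signatures spelled out verbatim; `sorry` lives only here) -/

/-- Registered stub `stub_strip4` (= `Sig.stub_strip4`, spelled out so that a `Theorems/` proof can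
restate it verbatim over importable declarations). -/
theorem stub_strip4 :
    ∀ z : ℂ,
      (4 : ℂ) * Literature.NumberTheory.LFunctions.riemannXiUpper z +
            Literature.NumberTheory.LFunctions.riemannXiUpper (z + Complex.I) +
          Literature.NumberTheory.LFunctions.riemannXiUpper (z - Complex.I) = 0 →
        |z.im| < 40 := by
  sorry

/-- Registered stub `stub_high4` (= `Sig.stub_high4`, spelled out). -/
theorem stub_high4 :
    ∀ z : ℂ,
      (4 : ℂ) * Literature.NumberTheory.LFunctions.riemannXiUpper z +
            Literature.NumberTheory.LFunctions.riemannXiUpper (z + Complex.I) +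
          Literature.NumberTheory.LFunctions.riemannXiUpper (z - Complex.I) = 0 →
        (3 * 10 ^ 7 : ℝ) ≤ |z.re| → |z.im| < 40 → z.im = 0 := by
  sorry

/-- Registered stub `stub_box4` (= `Sig.stub_box4`, spelled out). -/
theorem stub_box4 :
    ∀ z : ℂ,
      (4 : ℂ) * Literature.NumberTheory.LFunctions.riemannXiUpper z +
            Literature.NumberTheory.LFunctions.riemannXiUpper (z + Complex.I) +
          Literature.NumberTheory.LFunctions.riemannXiUpper (z - Complex.I) = 0 →
        |z.re| < (3 * 10 ^ 7 : ℝ) → |z.im| < 40 → z.im = 0 := by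
  sorry

/-! ## Composition (sorry-free) and the skeleton theorem -/

/-- **Composition.** The three stub statements imply the crux
`Summit.RiemannHypothesis.RiemannHypothesis.Theses.DisplacementPencil.PencilBase` BY NAME: a zero `z`
of `P₄` lies in the strip `|Im z| < 40` (stub 1); if `3·10⁷ ≤ |Re z|` it is real by the dominance /
comb lemma (stub 2), otherwise by the certified box (stub 3). -/
theorem PencilBase_of (hS : Sig.stub_strip4) (hH : Sig.stub_high4) (hB : Sig.stub_box4) :
    PencilBase := by
  intro z hz
  have hy : |z.im| < 40 := hS z hz
  by_cases h : (3 * 10 ^ 7 : ℝ) ≤ |z.re|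
  · exact hH z hz h hy
  · exact hB z hz (not_le.mp h) hy

/-- **The skeleton**: the crux BY NAME from the three registered stubs (depends on `sorryAx` only
through `stub_*`). -/
theorem PencilBase_proof : PencilBase :=
  PencilBase_of stub_strip4 stub_high4 stub_box4

/-! ## Calibration (sorry-free) -/

/-- The registered stubs are literally the `Sig` propositions. -/
example : (Sig.stub_strip4 ↔ ∀ z : ℂ,
      (4 : ℂ) * Literature.NumberTheory.LFunctions.riemannXiUpper z +
            Literature.NumberTheory.LFunctions.riemannXiUpper (z + Complex.I) +
          Literature.NumberTheory.LFunctions.riemannXiUpper (z - Complex.I) = 0 →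
        |z.im| < 40) ∧
    (Sig.stub_high4 ↔ ∀ z : ℂ,
      (4 : ℂ) * Literature.NumberTheory.LFunctions.riemannXiUpper z +
            Literature.NumberTheory.LFunctions.riemannXiUpper (z + Complex.I) +
          Literature.NumberTheory.LFunctions.riemannXiUpper (z - Complex.I) = 0 →
        (3 * 10 ^ 7 : ℝ) ≤ |z.re| → |z.im| < 40 → z.im = 0) ∧
    (Sig.stub_box4 ↔ ∀ z : ℂ,
      (4 : ℂ) * Literature.NumberTheory.LFunctions.riemannXiUpper z +
            Literature.NumberTheory.LFunctions.riemannXiUpper (z + Complex.I) +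
          Literature.NumberTheory.LFunctions.riemannXiUpper (z - Complex.I) = 0 →
        |z.re| < (3 * 10 ^ 7 : ℝ) → |z.im| < 40 → z.im = 0) :=
  ⟨Iff.rfl, Iff.rfl, Iff.rfl⟩

/-- Calibration: each stub is implied by the crux (stubs 2 and 3 are restrictions of `PencilBase` to
regions, stub 1 follows since real zeros have `|Im z| = 0 < 40`), so the cut loses no strength and no
stub is stronger than the crux. -/
example (h : PencilBase) : Sig.stub_strip4 ∧ Sig.stub_high4 ∧ Sig.stub_box4 := by
  refine ⟨fun z hz => ?_, fun z hz _ _ => h z hz, fun z hz _ _ => h z hz⟩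
  have him : z.im = 0 := h z hz
  rw [him, abs_zero]
  norm_num

end Summit.RiemannHypothesis.RiemannHypothesis.Cruxes.PencilBase.Birth
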